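import Literature.NumberTheory.LFunctions.Zhang2022.Section8Lemma84Estimate
import Literature.NumberTheory.LFunctions.Zhang2022.TypedSection12B

/-!
# Zhang (2022) §12, Lemmas 12.2–12.3: the small circle around `s = β₆ − w` — model comparison and residues

Topic `Literature/NumberTheory/LFunctions/Zhang2022` (Landau–Siegel audit tree; verdict-neutral).
Y. Zhang, *Discrete mean estimates and the Landau–Siegel zero*, arXiv:2211.02515v1 (2022)
[Zhang2022LandauSiegel] — **an unrefereed manuscript under adjudication** (lane ZHANG-L, WP12, helper row
«C-U025-helper»). Everything in this file is PROVED (theorems only; no new definitions, no new named facts);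
nothing here is a claim about Theorems 1–2 of the source or about Landau–Siegel zeros.

DAG nodes served: `Z22:§12.u025` (proof of Lemma 12.2, p. 69, tex L3534: "In a way similar to the proof of
Lemma 8.4, by lemma 8.2 and 5.8, we find that the right side above is equal to
`L′(1,χ)Π(d,r)·(2πi)⁻¹∫_{|s|=5α}(s+w−β₆+β_{j+1})(s+w−β₆+β_{j+2})/(s+w−β₆)·((P″₂/dr)^s − (P″₁/dr)^s)ds/s + O(𝓛⁻¹⁵)`")
and `Z22:§12.u030` (proof of Lemma 12.3, p. 70, tex L3564, the same with the kernel `(P″₂/dr)^s/s`), typed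
`Typed.Sec12B.U025 / U030` (OPEN cores of the ZHANG-L rows h1212 / hTop25Ex). In both, `|w| = α` and the
shifted argument `u = 1 − β₆ + w + s` of the Dirichlet series `Σ_l χ(l)ξ_j(l;d,r)l^{−u}` runs around the
point `u = 1`, i.e. around `s = β₆ − w` (`0 < |β₆ − w| ≤ 5α/2`). The tree's Lemma-8.4 engine
(`Section8Lemma84*`, shift `β_μ`, `Re β_μ = 0`) compares the true integrand
`𝔲(u)L(u+β_{j+1},χ)L(u+β_{j+2},χ)/L(u,χ)` (Lemma 8.3, relative form `Skeleton.Lemma83Rel`) with the MODEL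
`L′(1,χ)Π(d,r)(u−1+β_{j+1})(u−1+β_{j+2})/(u−1)` on a small rectangle around `β_μ`; here the shift `β₆ − w`
has `Re ≠ 0`, so this file supplies the shift-agnostic pieces a closer of `U025`/`U030` needs on the SMALL
CONTOUR (the large Perron/Landau contour with the Gaussian kernel `ω₁` is not touched):

* `norm_quot_sub_model_annulus` — the pointwise comparison on the annulus `α/2 ≤ |s| ≤ 7α/2`
  (`s = u − 1`): `‖𝔲(1+s)L(1+s+β_{j+1})L(1+s+β_{j+2})/L(1+s) − Π L′(1,χ)(s+β_{j+1})(s+β_{j+2})/s‖ ≤ Δ`,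
  `Δ = Π̂²(1+16e^{9/2}π²K²)𝓛⁻¹⁵(24K²+2K) + 32K³(C₈₃𝓛⁻⁸Π̂)(2e^{9/2}(1+𝓛)𝓛)α` (`Π̂ = ∏_{q∣dr}(1−q⁻¹)⁻¹`) —
  the core of `Lemma84.norm_Phi_sub_model_le` with the rectangle geometry replaced by the two norm bounds
  (Lemma 5.8 at the three `L`-values + `Lemma84.norm_quot_sub_model_le` + `‖Π‖ ≤ Π̂²`);
* `sphere_shift_bounds` — on the circle `|z − (β₆ − w)| = 3α` (`|w| = α`): `|z + w − β₆| = 3α`,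
  `α/2 ≤ |z| ≤ 11α/2`, `|(1 − β₆ + w + z) − 1| ≤ 5α` (so Lemma 8.3 (iii′) and the annulus lemma apply);
  `norm_quot_sub_model_on_shifted_sphere` — the comparison at `u = 1 − β₆ + w + z` on that circle;
* (private) `circleIntegral_comp_add_center` — `∮_{C(c,R)} f = ∮_{C(0,R)} f(c + ·)`;
* `circ_shift_kernel2_eq`, `circ_shift_kernel1_eq` — the MODEL integrals over `C(β₆ − w, 3α)` in closed form
  (residues at `z = β₆ − w` and, for the kernel `X₂^z/z`, at `z = 0`; via `Typed.Sec12B.circ_two_poles`):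
  the values are those of `Typed.Sec12B.circ025_eq` / `U031_holds` on the printed circle `|s| = 5α`, so a
  closer may run the comparison on `C(β₆ − w, 3α)` — where Lemma 8.3 (iii′) (`|u − 1| ≤ 5α`) is available,
  which is NOT the case on all of `|s| = 5α` (`|s + w − β₆| ≤ 15α/2` there) — and still conclude about the
  printed `circ025` / `circ030`;
* `norm_circ_kernel2_le`, `norm_circ_kernel1_le` — `‖(2πi)⁻¹∮_{C(β₆−w,3α)}(F − M)(z)·K(z)dz‖ ≤ 12e^{11π/2}Δ`
  (resp. `6e^{11π/2}Δ`) for the kernels `K = (X₂^z − X₁^z)/z`, `X₂^z/z`, `1 ≤ X_i ≤ P`, from a pointwise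
  bound `‖F − M‖ ≤ Δ` on the circle (`|X^z| ≤ P^{11α/2} = e^{11π/2}` as `α log P = π`).

What this is NOT: a proof of `U025` or `U030` (the line-to-circle contour shift, the Perron step u024 and
the size of `Σ|ξ_j|` tails are their owners' work); nor any statement about which error term is derivable —
note the factor `Π̂²` in `Δ` (as in `Skeleton.Lemma84Rel`, row G-d55-3): the absolute `O(𝓛⁻¹⁵)` printed in
u025/u030 comes out RELATIVE, `O(𝓛⁻¹⁵Π̂²)`, from Lemma 8.3 in the relative form.

## References

* Y. Zhang, arXiv:2211.02515v1 (2022), §12 proofs of Lemmas 12.2–12.3, pp. 69–70, tex L3528–L3586; §8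
  Lemma 8.4 (proof), p. 47; §5 Lemma 5.8. [cite: Zhang2022LandauSiegel, §12 Lemmas 12.2–12.3]
* H. L. Montgomery, R. C. Vaughan, *Multiplicative Number Theory I*, CUP 2007, §6.2.
  [cite: MontgomeryVaughan2007, §6.2]
-/

noncomputable section

open Complex Real Set Finset Metric

namespace Literature.NumberTheory.LFunctions.Zhang2022.Lemma84

open Skeleton

section Annulus

variable {D : ℕ} [NeZero D] (χ : DirichletCharacter ℂ D) (c' : ℝ)

/-- **The model comparison on the annulus `α/2 ≤ |s| ≤ 7α/2`** (the core of `norm_Phi_sub_model_le`,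
shift-agnostic). Let `χ` be primitive mod `D`, `𝓛 = log D ≥ 3`, (A) `‖L(1,χ)‖ ≤ 𝓛⁻²⁰²²`, `K ≥ 7 + 15|c′|`
with `Kπ ≤ 𝓛⁸`, `0 < ℓ₀ ≤ |L′(1,χ)|` with `(1 + 16e^{9/2}π²K²)𝓛⁻¹⁵ ≤ ℓ₀α/4`, and `𝔲` with
`‖𝔲(u) − Π(d,r)‖ ≤ C₈₃𝓛⁻⁸Π̂` for `|u − 1| ≤ 5α` (`Π̂ = ∏_{q∣dr}(1−q⁻¹)⁻¹`, Lemma 8.3 (iii′)). Then for every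
`s` with `α/2 ≤ |s| ≤ 7α/2`:
`‖𝔲(1+s)L(1+s+β_{j+1})L(1+s+β_{j+2})/L(1+s) − Π(d,r)L′(1,χ)(s+β_{j+1})(s+β_{j+2})/s‖ ≤
  Π̂²(1+16e^{9/2}π²K²)𝓛⁻¹⁵(24K²+2K) + 32K³(C₈₃𝓛⁻⁸Π̂)(2e^{9/2}(1+𝓛)𝓛)α`.
[cite: Zhang2022LandauSiegel, §8 Lemma 8.4 (proof, "By Lemma 5.5 and 5.6 … O(𝓛⁻¹⁵)"); §12 proof of Lemma 12.2, p. 69] -/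
theorem norm_quot_sub_model_annulus (hprim : χ.IsPrimitive) (h𝓛 : 3 ≤ Real.log D)
    (hA : ‖χ.LFunction 1‖ ≤ 1 / Real.log D ^ 2022) (j : ℕ) {d r : ℕ} (hd : d ≠ 0) (hr : r ≠ 0)
    (U : ℂ → ℂ) {C₈₃ K ℓ₀ : ℝ} (hC₈₃ : 0 ≤ C₈₃) (hK : 7 + 15 * |c'| ≤ K)
    (hKL : K * π ≤ Real.log D ^ 8) (hℓ₀ : 0 < ℓ₀) (hℓ : ℓ₀ ≤ ‖deriv χ.LFunction 1‖)
    (hE : (1 + 16 * Real.exp (9 / 2) * π ^ 2 * K ^ 2) / Real.log D ^ 15 ≤ ℓ₀ * alpha D / 4)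
    (hU3 : ∀ s : ℂ, ‖s - 1‖ ≤ 5 * alpha D → ‖U s - PiW χ d r‖ ≤
      C₈₃ * (ell D ^ 8)⁻¹ * ∏ q ∈ (d * r).primeFactors, (1 - (q : ℝ)⁻¹)⁻¹)
    {s : ℂ} (hs_lo : alpha D / 2 ≤ ‖s‖) (hs_hi : ‖s‖ ≤ 7 * alpha D / 2) :
    ‖U (1 + s) * χ.LFunction (1 + s + betaJ c' D (j + 1)) *
          χ.LFunction (1 + s + betaJ c' D (j + 2)) / χ.LFunction (1 + s) -
        PiW χ d r * deriv χ.LFunction 1 * (s + betaJ c' D (j + 1)) * (s + betaJ c' D (j + 2)) / s‖ ≤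
      (∏ q ∈ (d * r).primeFactors, (1 - (q : ℝ)⁻¹)⁻¹) ^ 2 *
          ((1 + 16 * Real.exp (9 / 2) * π ^ 2 * K ^ 2) / Real.log D ^ 15) * (24 * K ^ 2 + 2 * K) +
        32 * K ^ 3 * (C₈₃ * (ell D ^ 8)⁻¹ * ∏ q ∈ (d * r).primeFactors, (1 - (q : ℝ)⁻¹)⁻¹) *
          (2 * Real.exp (9 / 2) * (1 + Real.log D) * Real.log D) * alpha D := by
  set 𝓛 : ℝ := Real.log D with h𝓛def
  set α : ℝ := alpha D with hαdef
  set βa : ℂ := betaJ c' D (j + 1) with hβadef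
  set βb : ℂ := betaJ c' D (j + 2) with hβbdef
  set hatPi : ℝ := ∏ q ∈ (d * r).primeFactors, (1 - (q : ℝ)⁻¹)⁻¹ with hhatPi
  set E : ℝ := (1 + 16 * Real.exp (9 / 2) * π ^ 2 * K ^ 2) / 𝓛 ^ 15 with hEdef
  set ℓ : ℂ := deriv χ.LFunction 1 with hℓdef
  have hℓ1 : 1 ≤ ell D := by rw [ell]; linarith
  have hℓ2 : 2 ≤ ell D := by rw [ell]; linarith
  have hα0 : 0 < α := alpha_pos' (by linarith)
  have hαeq : α = π / 𝓛 ^ 9 := alpha_eq D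
  have hαℓ : α * ell D ≤ 1 := alpha_mul_ell_le_one hℓ2
  have hK1 : 1 ≤ K := by linarith [abs_nonneg c']
  -- sizes of the shifts
  have hβ : ∀ i : ℕ, ‖betaJ c' D i‖ ≤ 3 * α * (1 + 5 * |c'|) := by
    intro i
    have h := norm_betaJ_le c' D i hα0.le (by linarith : 0 ≤ ell D)
    refine h.trans ?_
    have : 5 * |c'| * alpha D * ell D ≤ 5 * |c'| := by
      calc 5 * |c'| * alpha D * ell D = 5 * |c'| * (alpha D * ell D) := by ring
        _ ≤ 5 * |c'| * 1 := by gcongr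
        _ = 5 * |c'| := mul_one _
    rw [← hαdef] at this ⊢
    nlinarith [abs_nonneg c']
  have hsK : ‖s‖ ≤ K * α := by nlinarith [abs_nonneg c']
  have hAK : ‖s + βa‖ ≤ K * α := by
    calc ‖s + βa‖ ≤ ‖s‖ + ‖βa‖ := norm_add_le _ _
      _ ≤ 7 * α / 2 + 3 * α * (1 + 5 * |c'|) := add_le_add hs_hi (hβ _)
      _ ≤ K * α := by nlinarith [abs_nonneg c']
  have hBK : ‖s + βb‖ ≤ K * α := by
    calc ‖s + βb‖ ≤ ‖s‖ + ‖βb‖ := norm_add_le _ _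
      _ ≤ 7 * α / 2 + 3 * α * (1 + 5 * |c'|) := add_le_add hs_hi (hβ _)
      _ ≤ K * α := by nlinarith [abs_nonneg c']
  -- Lemma 5.8 at the three points
  have h58 : ∀ z : ℂ, ‖z‖ ≤ K * α → ‖χ.LFunction (1 + z) - ℓ * z‖ ≤ E := by
    intro z hz
    have hz' : ‖(1 + z) - 1‖ ≤ K * π / Real.log D ^ 9 := by
      rw [add_sub_cancel_left, ← h𝓛def]
      calc ‖z‖ ≤ K * α := hz
        _ = K * π / 𝓛 ^ 9 := by rw [hαeq]; ring
    have h := Lemma58.lemma_5_8_of_le χ hprim h𝓛 hA hKL hz'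
    rw [add_sub_cancel_left] at h
    exact h
  have ha : ‖χ.LFunction (1 + s + βa) - ℓ * (s + βa)‖ ≤ E := by
    rw [add_assoc]; exact h58 _ hAK
  have hb : ‖χ.LFunction (1 + s + βb) - ℓ * (s + βb)‖ ≤ E := by
    rw [add_assoc]; exact h58 _ hBK
  have h0 : ‖χ.LFunction (1 + s) - ℓ * s‖ ≤ E := h58 _ hsK
  -- Lemma 8.3 (iii′) at `1 + s`
  have hu : ‖U (1 + s) - PiW χ d r‖ ≤ C₈₃ * (ell D ^ 8)⁻¹ * hatPi :=
    hU3 _ (by rw [add_sub_cancel_left]; linarith)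
  have hE0 : 0 ≤ E := by positivity
  have hEU0 : 0 ≤ C₈₃ * (ell D ^ 8)⁻¹ * hatPi := by
    have h0 : 0 ≤ hatPi := Finset.prod_nonneg fun q hq => by
      have hq2 : (2 : ℝ) ≤ q := by exact_mod_cast (Nat.prime_of_mem_primeFactors hq).two_le
      have : (q : ℝ)⁻¹ ≤ 1 / 2 := by rw [inv_eq_one_div]; gcongr
      exact inv_nonneg.2 (by linarith)
    positivity
  have hEℓ : E ≤ ℓ₀ * α / 4 := hE
  -- the algebraic comparison
  have hcmp := norm_quot_sub_model_le (u := U (1 + s)) (La := χ.LFunction (1 + s + βa))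
    (Lb := χ.LFunction (1 + s + βb)) (L0 := χ.LFunction (1 + s)) (Pv := PiW χ d r) (ℓ := ℓ)
    (s := s) (A := s + βa) (B := s + βb) hα0 hK1 hℓ₀ hℓ hE0 hEU0 hEℓ ha hb h0 hu hs_lo hsK hAK hBK
  refine hcmp.trans ?_
  -- `‖Π‖ ≤ Π̂²`, `‖ℓ‖ ≤ 2e^{9/2}(1+𝓛)𝓛`
  have hPi : ‖PiW χ d r‖ ≤ hatPi ^ 2 := norm_PiW_le_prodInv χ hd hr
  have hℓle : ‖ℓ‖ ≤ 2 * Real.exp (9 / 2) * (1 + 𝓛) * 𝓛 :=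
    Lemma31.norm_deriv_LFunction_le_near_one χ h𝓛 hprim (w := 1)
      (by rw [sub_self, norm_zero]; positivity)
  have hK0 : 0 ≤ 24 * K ^ 2 + 2 * K := by positivity
  gcongr

end Annulus

/-! ## The small circle `|z − (β₆ − w)| = 3α` -/

section ShiftedCircle

variable {D : ℕ}

/-- `|β₆| = 3α/2` ((2.22), `β₆ = 3iα/2`). [cite: Zhang2022LandauSiegel, §2 (2.22)] -/
theorem norm_beta6_eq (hα : 0 ≤ alpha D) : ‖beta6 D‖ = 3 * alpha D / 2 := by
  rw [beta6, norm_div, norm_mul, norm_mul, Complex.norm_I, Complex.norm_real,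
    Real.norm_of_nonneg hα]
  norm_num

/-- For `|w| = α` (`α > 0`): `β₆ − w ≠ 0` and `|β₆ − w| ≤ 5α/2 < 3α` — the point `s = β₆ − w` (the zero
of the model denominator `s + w − β₆`) lies inside the circle `|z − (β₆ − w)| = 3α` together with `z = 0`.
[cite: Zhang2022LandauSiegel, §12 proof of Lemma 12.2, p. 69] -/
theorem center_shift_bounds (hα : 0 < alpha D) {w : ℂ} (hw : ‖w‖ = alpha D) :
    beta6 D - w ≠ 0 ∧ ‖beta6 D - w‖ ≤ 5 * alpha D / 2 ∧ ‖beta6 D - w‖ < 3 * alpha D := by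
  have hb := norm_beta6_eq (D := D) hα.le
  have hle : ‖beta6 D - w‖ ≤ 5 * alpha D / 2 := by
    calc ‖beta6 D - w‖ ≤ ‖beta6 D‖ + ‖w‖ := norm_sub_le _ _
      _ = 5 * alpha D / 2 := by rw [hb, hw]; ring
  refine ⟨fun h => ?_, hle, by linarith⟩
  have : ‖beta6 D‖ = ‖w‖ := by rw [sub_eq_zero.mp h]
  rw [hb, hw] at this
  linarith

/-- **On the circle `|z − (β₆ − w)| = 3α`** (`|w| = α > 0`): `|z + w − β₆| = 3α` (so `α/2 ≤ · ≤ 7α/2`),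
`α/2 ≤ |z| ≤ 11α/2`, and `|(1 − β₆ + w + z) − 1| ≤ 5α` (the range of Lemma 8.3 (iii′)).
[cite: Zhang2022LandauSiegel, §12 proof of Lemma 12.2, p. 69] -/
theorem sphere_shift_bounds (hα : 0 < alpha D) {w : ℂ} (hw : ‖w‖ = alpha D) {z : ℂ}
    (hz : z ∈ sphere (beta6 D - w) (3 * alpha D)) :
    ‖z + w - beta6 D‖ = 3 * alpha D ∧ alpha D / 2 ≤ ‖z‖ ∧ ‖z‖ ≤ 11 * alpha D / 2 ∧
      ‖(1 - beta6 D + w + z) - 1‖ ≤ 5 * alpha D := by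
  obtain ⟨-, hc, -⟩ := center_shift_bounds hα hw
  have hz' : ‖z - (beta6 D - w)‖ = 3 * alpha D := by simpa [dist_eq_norm] using hz
  have h1 : ‖z + w - beta6 D‖ = 3 * alpha D := by
    rw [show z + w - beta6 D = z - (beta6 D - w) by ring]; exact hz'
  have hα3 : 0 ≤ 3 * alpha D := by positivity
  refine ⟨h1, ?_, ?_, ?_⟩
  · -- `|z| ≥ |z − c₀| − |c₀| ≥ 3α − 5α/2`
    have h := norm_sub_le z (beta6 D - w)
    have h' : ‖z - (beta6 D - w)‖ ≤ ‖z‖ + ‖beta6 D - w‖ := norm_sub_le _ _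
    linarith
  · -- `|z| ≤ |z − c₀| + |c₀| ≤ 3α + 5α/2`
    have h' : ‖z‖ ≤ ‖z - (beta6 D - w)‖ + ‖beta6 D - w‖ := by
      have := norm_add_le (z - (beta6 D - w)) (beta6 D - w)
      rwa [sub_add_cancel] at this
    linarith
  · rw [show (1 - beta6 D + w + z) - 1 = z + w - beta6 D by ring, h1]
    linarith


/-- **The model comparison at `u = 1 − β₆ + w + z` on the circle `|z − (β₆ − w)| = 3α`** (`|w| = α`): the
annulus lemma at `s = z + w − β₆` (`|s| = 3α`). This is the pointwise input for the small-contour step of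
`Z22:§12.u025` / `u030` when the contour is taken around `s = β₆ − w`.
[cite: Zhang2022LandauSiegel, §12 proof of Lemma 12.2, p. 69; proof of Lemma 12.3, p. 70] -/
theorem norm_quot_sub_model_on_shifted_sphere [NeZero D] (χ : DirichletCharacter ℂ D) (c' : ℝ)
    (hprim : χ.IsPrimitive) (h𝓛 : 3 ≤ Real.log D)
    (hA : ‖χ.LFunction 1‖ ≤ 1 / Real.log D ^ 2022) (j : ℕ) {d r : ℕ} (hd : d ≠ 0) (hr : r ≠ 0)
    (U : ℂ → ℂ) {C₈₃ K ℓ₀ : ℝ} (hC₈₃ : 0 ≤ C₈₃) (hK : 7 + 15 * |c'| ≤ K)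
    (hKL : K * π ≤ Real.log D ^ 8) (hℓ₀ : 0 < ℓ₀) (hℓ : ℓ₀ ≤ ‖deriv χ.LFunction 1‖)
    (hE : (1 + 16 * Real.exp (9 / 2) * π ^ 2 * K ^ 2) / Real.log D ^ 15 ≤ ℓ₀ * alpha D / 4)
    (hU3 : ∀ s : ℂ, ‖s - 1‖ ≤ 5 * alpha D → ‖U s - PiW χ d r‖ ≤
      C₈₃ * (ell D ^ 8)⁻¹ * ∏ q ∈ (d * r).primeFactors, (1 - (q : ℝ)⁻¹)⁻¹)
    {w : ℂ} (hw : ‖w‖ = alpha D) {z : ℂ} (hz : z ∈ sphere (beta6 D - w) (3 * alpha D)) :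
    ‖U (1 - beta6 D + w + z) * χ.LFunction (1 - beta6 D + w + z + betaJ c' D (j + 1)) *
          χ.LFunction (1 - beta6 D + w + z + betaJ c' D (j + 2)) / χ.LFunction (1 - beta6 D + w + z) -
        PiW χ d r * deriv χ.LFunction 1 * (z + w - beta6 D + betaJ c' D (j + 1)) *
          (z + w - beta6 D + betaJ c' D (j + 2)) / (z + w - beta6 D)‖ ≤
      (∏ q ∈ (d * r).primeFactors, (1 - (q : ℝ)⁻¹)⁻¹) ^ 2 *
          ((1 + 16 * Real.exp (9 / 2) * π ^ 2 * K ^ 2) / Real.log D ^ 15) * (24 * K ^ 2 + 2 * K) +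
        32 * K ^ 3 * (C₈₃ * (ell D ^ 8)⁻¹ * ∏ q ∈ (d * r).primeFactors, (1 - (q : ℝ)⁻¹)⁻¹) *
          (2 * Real.exp (9 / 2) * (1 + Real.log D) * Real.log D) * alpha D := by
  have hℓ1 : 1 ≤ ell D := by rw [ell]; linarith
  have hα : 0 < alpha D := alpha_pos' (by linarith)
  obtain ⟨h1, -, -, -⟩ := sphere_shift_bounds hα hw hz
  have hs_lo : alpha D / 2 ≤ ‖z + w - beta6 D‖ := by rw [h1]; linarith
  have hs_hi : ‖z + w - beta6 D‖ ≤ 7 * alpha D / 2 := by rw [h1]; linarith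
  have h := norm_quot_sub_model_annulus χ c' hprim h𝓛 hA j hd hr U hC₈₃ hK hKL hℓ₀ hℓ hE hU3
    hs_lo hs_hi
  have e : 1 + (z + w - beta6 D) = 1 - beta6 D + w + z := by ring
  rw [e] at h
  exact h

/-- Translation of a circle integral to the centre `0`: `∮_{C(c,R)} f(z)dz = ∮_{C(0,R)} f(c + z)dz`.
[folklore] -/
private theorem circleIntegral_comp_add_center (f : ℂ → ℂ) (c : ℂ) (R : ℝ) :
    (∮ z in C(c, R), f z) = ∮ z in C(0, R), f (c + z) := by
  simp only [circleIntegral, deriv_circleMap, circleMap, zero_add]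

/-- **The MODEL integral of `Z22:§12.u025` over the circle `|z − (β₆ − w)| = 3α`, in closed form**:
`(2πi)⁻¹∮_{C(β₆−w,3α)} (z+w−β₆+β_a)(z+w−β₆+β_b)/(z+w−β₆)·(X₂^z − X₁^z)/z dz = β_aβ_b(X₂^{β₆−w} − X₁^{β₆−w})/(β₆−w)`
(`|w| = α`, `X₁, X₂ > 0`; the only pole inside is `z = β₆ − w`, the numerator vanishing at `z = 0`) — the same
value as the printed circle `|s| = 5α` (`Typed.Sec12B.circ025_eq`). [cite: Zhang2022LandauSiegel, §12 proof of Lemma 12.2, p. 69, tex L3534] -/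
theorem circ_shift_kernel2_eq (hα : 0 < alpha D) {w : ℂ} (hw : ‖w‖ = alpha D) (βa βb : ℂ)
    {X₁ X₂ : ℝ} (hX₁ : 0 < X₁) (hX₂ : 0 < X₂) :
    (2 * π * I)⁻¹ * (∮ z in C(beta6 D - w, 3 * alpha D),
        (z + w - beta6 D + βa) * (z + w - beta6 D + βb) / (z + w - beta6 D) *
          ((((X₂ : ℝ) : ℂ) ^ z - ((X₁ : ℝ) : ℂ) ^ z) / z)) =
      βa * βb * ((((X₂ : ℝ) : ℂ) ^ (beta6 D - w) - ((X₁ : ℝ) : ℂ) ^ (beta6 D - w)) /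
        (beta6 D - w)) := by
  obtain ⟨hc0, -, hc3⟩ := center_shift_bounds hα hw
  have h1 : ((X₁ : ℝ) : ℂ) ≠ 0 := by exact_mod_cast hX₁.ne'
  have h2 : ((X₂ : ℝ) : ℂ) ≠ 0 := by exact_mod_cast hX₂.ne'
  set G : ℂ → ℂ := fun t => (t + βa) * (t + βb) *
    (((X₂ : ℝ) : ℂ) ^ (beta6 D - w + t) - ((X₁ : ℝ) : ℂ) ^ (beta6 D - w + t)) with hGdef
  have hGd : DifferentiableOn ℂ G (closedBall 0 (3 * alpha D)) := by
    intro t _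
    refine DifferentiableAt.differentiableWithinAt ?_
    refine DifferentiableAt.mul (DifferentiableAt.mul (by fun_prop) (by fun_prop)) ?_
    exact ((differentiableAt_id.const_add (beta6 D - w)).const_cpow (Or.inl h2)).sub
      ((differentiableAt_id.const_add (beta6 D - w)).const_cpow (Or.inl h1))
  have key : (∮ z in C(beta6 D - w, 3 * alpha D),
        (z + w - beta6 D + βa) * (z + w - beta6 D + βb) / (z + w - beta6 D) *
          ((((X₂ : ℝ) : ℂ) ^ z - ((X₁ : ℝ) : ℂ) ^ z) / z)) =
      ∮ z in C(0, 3 * alpha D), G z / ((z + (beta6 D - w)) * z) := by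
    rw [circleIntegral_comp_add_center]
    refine circleIntegral.integral_congr (by positivity) fun z _ => ?_
    have e1 : beta6 D - w + z + w - beta6 D = z := by ring
    simp only [hGdef, e1]
    rw [div_mul_div_comm]
    ring
  rw [key, Typed.Sec12B.circ_two_poles hc0 hc3 hGd, hGdef]
  simp only [zero_add, add_zero, add_neg_cancel, Complex.cpow_zero, sub_self, mul_zero, sub_zero]
  ring

/-- **The MODEL integral of `Z22:§12.u030` over the circle `|z − (β₆ − w)| = 3α`, in closed form**:
`(2πi)⁻¹∮_{C(β₆−w,3α)} (z+w−β₆+β_a)(z+w−β₆+β_b)/(z+w−β₆)·X₂^z/z dz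
 = (β_aβ_bX₂^{β₆−w} − (β_a − (β₆−w))(β_b − (β₆−w)))/(β₆ − w)` (poles at `z = β₆ − w` and `z = 0`) — equal to
`w − β₆ + β_a + β_b + β_aβ_b(X₂^{β₆−w} − 1)/(β₆−w)`, the value of the printed circle (`Typed.Sec12B.U031_holds`).
[cite: Zhang2022LandauSiegel, §12 proof of Lemma 12.3, p. 70, tex L3564–L3577] -/
theorem circ_shift_kernel1_eq (hα : 0 < alpha D) {w : ℂ} (hw : ‖w‖ = alpha D) (βa βb : ℂ)
    {X₂ : ℝ} (hX₂ : 0 < X₂) :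
    (2 * π * I)⁻¹ * (∮ z in C(beta6 D - w, 3 * alpha D),
        (z + w - beta6 D + βa) * (z + w - beta6 D + βb) / (z + w - beta6 D) *
          (((X₂ : ℝ) : ℂ) ^ z / z)) =
      (βa * βb * ((X₂ : ℝ) : ℂ) ^ (beta6 D - w) - (βa - (beta6 D - w)) * (βb - (beta6 D - w))) /
        (beta6 D - w) := by
  obtain ⟨hc0, -, hc3⟩ := center_shift_bounds hα hw
  have h2 : ((X₂ : ℝ) : ℂ) ≠ 0 := by exact_mod_cast hX₂.ne'
  set G : ℂ → ℂ := fun t => (t + βa) * (t + βb) * ((X₂ : ℝ) : ℂ) ^ (beta6 D - w + t) with hGdef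
  have hGd : DifferentiableOn ℂ G (closedBall 0 (3 * alpha D)) := by
    intro t _
    refine DifferentiableAt.differentiableWithinAt ?_
    refine DifferentiableAt.mul (DifferentiableAt.mul (by fun_prop) (by fun_prop)) ?_
    exact (differentiableAt_id.const_add (beta6 D - w)).const_cpow (Or.inl h2)
  have key : (∮ z in C(beta6 D - w, 3 * alpha D),
        (z + w - beta6 D + βa) * (z + w - beta6 D + βb) / (z + w - beta6 D) *
          (((X₂ : ℝ) : ℂ) ^ z / z)) =
      ∮ z in C(0, 3 * alpha D), G z / ((z + (beta6 D - w)) * z) := by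
    rw [circleIntegral_comp_add_center]
    refine circleIntegral.integral_congr (by positivity) fun z _ => ?_
    have e1 : beta6 D - w + z + w - beta6 D = z := by ring
    simp only [hGdef, e1]
    rw [div_mul_div_comm]
    ring
  rw [key, Typed.Sec12B.circ_two_poles hc0 hc3 hGd, hGdef]
  simp only [zero_add, add_neg_cancel, Complex.cpow_zero, mul_one]
  ring

/-- The same value rearranged as on p. 70: `w − β₆ + β_a + β_b + β_aβ_b(X₂^{β₆−w} − 1)/(β₆ − w)`.
[cite: Zhang2022LandauSiegel, §12 proof of Lemma 12.3, p. 70, tex L3577] -/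
theorem circ_shift_kernel1_eq' (hα : 0 < alpha D) {w : ℂ} (hw : ‖w‖ = alpha D) (βa βb : ℂ)
    {X₂ : ℝ} (hX₂ : 0 < X₂) :
    (2 * π * I)⁻¹ * (∮ z in C(beta6 D - w, 3 * alpha D),
        (z + w - beta6 D + βa) * (z + w - beta6 D + βb) / (z + w - beta6 D) *
          (((X₂ : ℝ) : ℂ) ^ z / z)) =
      w - beta6 D + βa + βb + βa * βb * ((((X₂ : ℝ) : ℂ) ^ (beta6 D - w) - 1) / (beta6 D - w)) := by
  obtain ⟨hc0, -, -⟩ := center_shift_bounds hα hw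
  rw [circ_shift_kernel1_eq hα hw βa βb hX₂]
  field_simp
  ring

/-- `α·log P = π` ((2.6), (2.10): `P = exp(𝓛⁹)`, `α = π/log P`), for `𝓛 ≥ 1`. [cite: Zhang2022LandauSiegel, §2 (2.10)] -/
private theorem log_bigP_mul_alpha (hL : 1 ≤ ell D) : Real.log (bigP D) * alpha D = π := by
  have hlog : Real.log (bigP D) = ell D ^ 9 := by rw [bigP, Real.log_exp]
  have h9 : ell D ^ 9 ≠ 0 := pow_ne_zero _ (by linarith)
  rw [alpha, hlog]
  field_simp

/-- On `|z| ≤ 11α/2` and for `1 ≤ X ≤ P`: `|X^z| ≤ P^{11α/2} = e^{11π/2}` (`α log P = π`).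
[cite: Zhang2022LandauSiegel, §12 proof of Lemma 12.2, p. 69] -/
theorem norm_cpow_le_exp (hL : 1 ≤ ell D) {X : ℝ} (hX : 1 ≤ X) (hXP : X ≤ bigP D) {z : ℂ}
    (hz : ‖z‖ ≤ 11 * alpha D / 2) : ‖((X : ℝ) : ℂ) ^ z‖ ≤ Real.exp (11 * π / 2) := by
  have hX0 : 0 < X := by linarith
  rw [Complex.norm_cpow_eq_rpow_re_of_pos hX0]
  have hre : z.re ≤ 11 * alpha D / 2 := (Complex.re_le_norm z).trans hz
  have hα : 0 < alpha D := alpha_pos' (by linarith)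
  calc X ^ z.re ≤ X ^ (11 * alpha D / 2) := Real.rpow_le_rpow_of_exponent_le hX hre
    _ ≤ bigP D ^ (11 * alpha D / 2) := Real.rpow_le_rpow (by linarith) hXP (by positivity)
    _ = Real.exp (11 * π / 2) := by
        rw [Real.rpow_def_of_pos (bigP_pos D)]
        congr 1
        have h := log_bigP_mul_alpha (D := D) hL
        calc Real.log (bigP D) * (11 * alpha D / 2) = 11 * (Real.log (bigP D) * alpha D) / 2 := by ring
          _ = 11 * π / 2 := by rw [h]

/-- `‖(2πi)⁻¹‖ = (2π)⁻¹`. [folklore] -/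
private theorem norm_two_pi_I_inv : ‖(2 * π * I : ℂ)⁻¹‖ = (2 * π)⁻¹ := by
  rw [norm_inv, norm_mul, norm_mul, Complex.norm_I, mul_one, Complex.norm_real, Real.norm_eq_abs,
    abs_of_pos Real.pi_pos]
  norm_num

/-- **From a pointwise comparison to the circle integral, kernel `(X₂^z − X₁^z)/z`** (`Z22:§12.u025`): if
`‖F(z) − M(z)‖ ≤ Δ` on `|z − (β₆ − w)| = 3α` (`|w| = α`, `𝓛 ≥ 1`) and `1 ≤ X₁, X₂ ≤ P`, then
`‖(2πi)⁻¹∮_{C(β₆−w,3α)} (F − M)(z)·(X₂^z − X₁^z)/z dz‖ ≤ 12e^{11π/2}Δ`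
(`|z| ≥ α/2` and `|X_i^z| ≤ e^{11π/2}` on the circle, length `6πα`).
[cite: Zhang2022LandauSiegel, §12 proof of Lemma 12.2, p. 69, tex L3534] -/
theorem norm_circ_kernel2_le (hL : 1 ≤ ell D) {w : ℂ} (hw : ‖w‖ = alpha D) {X₁ X₂ : ℝ}
    (hX₁ : 1 ≤ X₁) (hX₁P : X₁ ≤ bigP D) (hX₂ : 1 ≤ X₂) (hX₂P : X₂ ≤ bigP D)
    {F M : ℂ → ℂ} {Δ : ℝ} (hΔ : ∀ z ∈ sphere (beta6 D - w) (3 * alpha D), ‖F z - M z‖ ≤ Δ) :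
    ‖(2 * π * I)⁻¹ * (∮ z in C(beta6 D - w, 3 * alpha D),
        (F z - M z) * ((((X₂ : ℝ) : ℂ) ^ z - ((X₁ : ℝ) : ℂ) ^ z) / z))‖ ≤
      12 * Real.exp (11 * π / 2) * Δ := by
  have hα : 0 < alpha D := alpha_pos' (by linarith)
  set e : ℝ := Real.exp (11 * π / 2) with he
  have he0 : 0 < e := Real.exp_pos _
  -- `Δ ≥ 0` (the circle is nonempty)
  have hΔ0 : 0 ≤ Δ := by
    have hz0 : beta6 D - w + ((3 * alpha D : ℝ) : ℂ) ∈ sphere (beta6 D - w) (3 * alpha D) := by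
      rw [mem_sphere, dist_eq_norm, add_sub_cancel_left, Complex.norm_real, Real.norm_eq_abs,
        abs_of_pos (by positivity)]
    exact (norm_nonneg _).trans (hΔ _ hz0)
  -- pointwise bound on the circle
  have hpt : ∀ z ∈ sphere (beta6 D - w) (3 * alpha D),
      ‖(F z - M z) * ((((X₂ : ℝ) : ℂ) ^ z - ((X₁ : ℝ) : ℂ) ^ z) / z)‖ ≤ Δ * (2 * e / (alpha D / 2)) := by
    intro z hz
    obtain ⟨-, hzlo, hzhi, -⟩ := sphere_shift_bounds hα hw hz
    have hz0 : 0 < ‖z‖ := lt_of_lt_of_le (by positivity) hzlo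
    have hnum : ‖((X₂ : ℝ) : ℂ) ^ z - ((X₁ : ℝ) : ℂ) ^ z‖ ≤ 2 * e :=
      calc ‖((X₂ : ℝ) : ℂ) ^ z - ((X₁ : ℝ) : ℂ) ^ z‖
          ≤ ‖((X₂ : ℝ) : ℂ) ^ z‖ + ‖((X₁ : ℝ) : ℂ) ^ z‖ := norm_sub_le _ _
        _ ≤ e + e := add_le_add (norm_cpow_le_exp hL hX₂ hX₂P hzhi) (norm_cpow_le_exp hL hX₁ hX₁P hzhi)
        _ = 2 * e := by ring
    rw [norm_mul, norm_div]
    refine mul_le_mul (hΔ z hz) ?_ (by positivity) hΔ0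
    exact div_le_div₀ (by positivity) hnum (by positivity) hzlo
  have hI := circleIntegral.norm_integral_le_of_norm_le_const (by positivity) hpt
  rw [norm_mul, norm_two_pi_I_inv]
  calc (2 * π)⁻¹ * ‖∮ z in C(beta6 D - w, 3 * alpha D),
          (F z - M z) * ((((X₂ : ℝ) : ℂ) ^ z - ((X₁ : ℝ) : ℂ) ^ z) / z)‖
      ≤ (2 * π)⁻¹ * (2 * π * (3 * alpha D) * (Δ * (2 * e / (alpha D / 2)))) :=
        mul_le_mul_of_nonneg_left hI (by positivity)
    _ = 12 * e * Δ := by field_simp; ring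

/-- **From a pointwise comparison to the circle integral, kernel `X₂^z/z`** (`Z22:§12.u030`): under the same
hypotheses, `‖(2πi)⁻¹∮_{C(β₆−w,3α)} (F − M)(z)·X₂^z/z dz‖ ≤ 6e^{11π/2}Δ`.
[cite: Zhang2022LandauSiegel, §12 proof of Lemma 12.3, p. 70, tex L3564] -/
theorem norm_circ_kernel1_le (hL : 1 ≤ ell D) {w : ℂ} (hw : ‖w‖ = alpha D) {X₂ : ℝ}
    (hX₂ : 1 ≤ X₂) (hX₂P : X₂ ≤ bigP D)
    {F M : ℂ → ℂ} {Δ : ℝ} (hΔ : ∀ z ∈ sphere (beta6 D - w) (3 * alpha D), ‖F z - M z‖ ≤ Δ) :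
    ‖(2 * π * I)⁻¹ * (∮ z in C(beta6 D - w, 3 * alpha D),
        (F z - M z) * (((X₂ : ℝ) : ℂ) ^ z / z))‖ ≤ 6 * Real.exp (11 * π / 2) * Δ := by
  have hα : 0 < alpha D := alpha_pos' (by linarith)
  set e : ℝ := Real.exp (11 * π / 2) with he
  have he0 : 0 < e := Real.exp_pos _
  have hΔ0 : 0 ≤ Δ := by
    have hz0 : beta6 D - w + ((3 * alpha D : ℝ) : ℂ) ∈ sphere (beta6 D - w) (3 * alpha D) := by
      rw [mem_sphere, dist_eq_norm, add_sub_cancel_left, Complex.norm_real, Real.norm_eq_abs,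
        abs_of_pos (by positivity)]
    exact (norm_nonneg _).trans (hΔ _ hz0)
  have hpt : ∀ z ∈ sphere (beta6 D - w) (3 * alpha D),
      ‖(F z - M z) * (((X₂ : ℝ) : ℂ) ^ z / z)‖ ≤ Δ * (e / (alpha D / 2)) := by
    intro z hz
    obtain ⟨-, hzlo, hzhi, -⟩ := sphere_shift_bounds hα hw hz
    have hz0 : 0 < ‖z‖ := lt_of_lt_of_le (by positivity) hzlo
    rw [norm_mul, norm_div]
    refine mul_le_mul (hΔ z hz) ?_ (by positivity) hΔ0
    exact div_le_div₀ he0.le (norm_cpow_le_exp hL hX₂ hX₂P hzhi) (by positivity) hzlo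
  have hI := circleIntegral.norm_integral_le_of_norm_le_const (by positivity) hpt
  rw [norm_mul, norm_two_pi_I_inv]
  calc (2 * π)⁻¹ * ‖∮ z in C(beta6 D - w, 3 * alpha D), (F z - M z) * (((X₂ : ℝ) : ℂ) ^ z / z)‖
      ≤ (2 * π)⁻¹ * (2 * π * (3 * alpha D) * (Δ * (e / (alpha D / 2)))) :=
        mul_le_mul_of_nonneg_left hI (by positivity)
    _ = 6 * e * Δ := by field_simp; ring


/-- **The MODEL integrand is circle-integrable** on `|z − (β₆ − w)| = 3α` (kernel `(X₂^z − X₁^z)/z`): its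
only singularities `z = β₆ − w` (the centre) and `z = 0` (`|z| ≥ α/2` on the circle) are off the circle.
[cite: Zhang2022LandauSiegel, §12 proof of Lemma 12.2, p. 69] -/
theorem circleIntegrable_model_kernel2 (hα : 0 < alpha D) {w : ℂ} (hw : ‖w‖ = alpha D) (A βa βb : ℂ)
    {X₁ X₂ : ℝ} (hX₁ : 0 < X₁) (hX₂ : 0 < X₂) :
    CircleIntegrable (fun z : ℂ => A * (z + w - beta6 D + βa) * (z + w - beta6 D + βb) / (z + w - beta6 D) *
      ((((X₂ : ℝ) : ℂ) ^ z - ((X₁ : ℝ) : ℂ) ^ z) / z)) (beta6 D - w) (3 * alpha D) := by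
  refine ContinuousOn.circleIntegrable (by positivity) ?_
  have h1 : ((X₁ : ℝ) : ℂ) ≠ 0 := by exact_mod_cast hX₁.ne'
  have h2 : ((X₂ : ℝ) : ℂ) ≠ 0 := by exact_mod_cast hX₂.ne'
  intro z hz
  obtain ⟨hn, hzlo, -, -⟩ := sphere_shift_bounds hα hw hz
  have hz0 : z ≠ 0 := by
    intro h; rw [h, norm_zero] at hzlo; linarith
  have hd : z + w - beta6 D ≠ 0 := by
    intro h; rw [h, norm_zero] at hn; linarith
  refine ContinuousAt.continuousWithinAt ?_
  refine ContinuousAt.mul (ContinuousAt.div (by fun_prop) (by fun_prop) hd) ?_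
  refine ContinuousAt.div ?_ continuousAt_id hz0
  exact (continuousAt_id.const_cpow (Or.inl h2)).sub (continuousAt_id.const_cpow (Or.inl h1))

/-- **The MODEL integrand is circle-integrable** on `|z − (β₆ − w)| = 3α` (kernel `X₂^z/z`).
[cite: Zhang2022LandauSiegel, §12 proof of Lemma 12.3, p. 70] -/
theorem circleIntegrable_model_kernel1 (hα : 0 < alpha D) {w : ℂ} (hw : ‖w‖ = alpha D) (A βa βb : ℂ)
    {X₂ : ℝ} (hX₂ : 0 < X₂) :
    CircleIntegrable (fun z : ℂ => A * (z + w - beta6 D + βa) * (z + w - beta6 D + βb) / (z + w - beta6 D) *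
      (((X₂ : ℝ) : ℂ) ^ z / z)) (beta6 D - w) (3 * alpha D) := by
  refine ContinuousOn.circleIntegrable (by positivity) ?_
  have h2 : ((X₂ : ℝ) : ℂ) ≠ 0 := by exact_mod_cast hX₂.ne'
  intro z hz
  obtain ⟨hn, hzlo, -, -⟩ := sphere_shift_bounds hα hw hz
  have hz0 : z ≠ 0 := by
    intro h; rw [h, norm_zero] at hzlo; linarith
  have hd : z + w - beta6 D ≠ 0 := by
    intro h; rw [h, norm_zero] at hn; linarith
  refine ContinuousAt.continuousWithinAt ?_
  refine ContinuousAt.mul (ContinuousAt.div (by fun_prop) (by fun_prop) hd) ?_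
  exact ContinuousAt.div (continuousAt_id.const_cpow (Or.inl h2)) continuousAt_id hz0

/-- **The small-circle step of `Z22:§12.u025`, assembled**: if `F·K` is circle-integrable on
`|z − (β₆ − w)| = 3α` (`K(z) = (X₂^z − X₁^z)/z`, `1 ≤ X₁, X₂ ≤ P`, `|w| = α`, `𝓛 ≥ 1`) and
`‖F(z) − A·Π′(z)‖ ≤ Δ` there, `Π′(z) = (z+w−β₆+β_a)(z+w−β₆+β_b)/(z+w−β₆)` the model factor, then
`‖(2πi)⁻¹∮ F·K − A·β_aβ_b(X₂^{β₆−w} − X₁^{β₆−w})/(β₆−w)‖ ≤ 12e^{11π/2}Δ` (`A` = `L′(1,χ)Π(d,r)` in the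
application, `F(z) = 𝔲(u)L(u+β_{j+1})L(u+β_{j+2})/L(u)`, `u = 1 − β₆ + w + z`, `Δ` from
`norm_quot_sub_model_on_shifted_sphere`; the model's own integral is `circ_shift_kernel2_eq`).
[cite: Zhang2022LandauSiegel, §12 proof of Lemma 12.2, p. 69, tex L3534] -/
theorem norm_circ_sub_residue_kernel2_le (hL : 1 ≤ ell D) {w : ℂ} (hw : ‖w‖ = alpha D) {X₁ X₂ : ℝ}
    (hX₁ : 1 ≤ X₁) (hX₁P : X₁ ≤ bigP D) (hX₂ : 1 ≤ X₂) (hX₂P : X₂ ≤ bigP D) (A βa βb : ℂ)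
    {F : ℂ → ℂ} {Δ : ℝ}
    (hFi : CircleIntegrable (fun z : ℂ => F z * ((((X₂ : ℝ) : ℂ) ^ z - ((X₁ : ℝ) : ℂ) ^ z) / z))
      (beta6 D - w) (3 * alpha D))
    (hΔ : ∀ z ∈ sphere (beta6 D - w) (3 * alpha D),
      ‖F z - A * (z + w - beta6 D + βa) * (z + w - beta6 D + βb) / (z + w - beta6 D)‖ ≤ Δ) :
    ‖(2 * π * I)⁻¹ * (∮ z in C(beta6 D - w, 3 * alpha D),
          F z * ((((X₂ : ℝ) : ℂ) ^ z - ((X₁ : ℝ) : ℂ) ^ z) / z)) -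
        A * (βa * βb * ((((X₂ : ℝ) : ℂ) ^ (beta6 D - w) - ((X₁ : ℝ) : ℂ) ^ (beta6 D - w)) /
          (beta6 D - w)))‖ ≤ 12 * Real.exp (11 * π / 2) * Δ := by
  have hα : 0 < alpha D := alpha_pos' (by linarith)
  have hX₁0 : 0 < X₁ := by linarith
  have hX₂0 : 0 < X₂ := by linarith
  have hMi := circleIntegrable_model_kernel2 hα hw A βa βb hX₁0 hX₂0
  -- the model's integral, with the constant `A` pulled out
  have hMval : (2 * π * I)⁻¹ * (∮ z in C(beta6 D - w, 3 * alpha D),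
      A * (z + w - beta6 D + βa) * (z + w - beta6 D + βb) / (z + w - beta6 D) *
        ((((X₂ : ℝ) : ℂ) ^ z - ((X₁ : ℝ) : ℂ) ^ z) / z)) =
      A * (βa * βb * ((((X₂ : ℝ) : ℂ) ^ (beta6 D - w) - ((X₁ : ℝ) : ℂ) ^ (beta6 D - w)) /
        (beta6 D - w))) := by
    have hcongr : (∮ z in C(beta6 D - w, 3 * alpha D),
        A * (z + w - beta6 D + βa) * (z + w - beta6 D + βb) / (z + w - beta6 D) *
          ((((X₂ : ℝ) : ℂ) ^ z - ((X₁ : ℝ) : ℂ) ^ z) / z)) =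
        ∮ z in C(beta6 D - w, 3 * alpha D), A • ((z + w - beta6 D + βa) * (z + w - beta6 D + βb) /
          (z + w - beta6 D) * ((((X₂ : ℝ) : ℂ) ^ z - ((X₁ : ℝ) : ℂ) ^ z) / z)) :=
      circleIntegral.integral_congr (by positivity) fun z _ => by simp only [smul_eq_mul]; ring
    rw [hcongr, circleIntegral.integral_smul, smul_eq_mul, ← mul_assoc, mul_comm ((2 * π * I)⁻¹) A,
      mul_assoc, circ_shift_kernel2_eq hα hw βa βb hX₁0 hX₂0]
  -- subtract and bound
  have hsub : (∮ z in C(beta6 D - w, 3 * alpha D),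
        F z * ((((X₂ : ℝ) : ℂ) ^ z - ((X₁ : ℝ) : ℂ) ^ z) / z)) -
      (∮ z in C(beta6 D - w, 3 * alpha D),
        A * (z + w - beta6 D + βa) * (z + w - beta6 D + βb) / (z + w - beta6 D) *
          ((((X₂ : ℝ) : ℂ) ^ z - ((X₁ : ℝ) : ℂ) ^ z) / z)) =
      ∮ z in C(beta6 D - w, 3 * alpha D),
        (F z - A * (z + w - beta6 D + βa) * (z + w - beta6 D + βb) / (z + w - beta6 D)) *
          ((((X₂ : ℝ) : ℂ) ^ z - ((X₁ : ℝ) : ℂ) ^ z) / z) := by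
    rw [← circleIntegral.integral_sub hFi hMi]
    exact circleIntegral.integral_congr (by positivity) fun z _ => by ring
  rw [← hMval, ← mul_sub, hsub]
  exact norm_circ_kernel2_le hL hw hX₁ hX₁P hX₂ hX₂P hΔ

/-- **The small-circle step of `Z22:§12.u030`, assembled** (kernel `X₂^z/z`): under the same hypotheses,
`‖(2πi)⁻¹∮ F·X₂^z/z dz − A·(β_aβ_bX₂^{β₆−w} − (β_a−(β₆−w))(β_b−(β₆−w)))/(β₆−w)‖ ≤ 6e^{11π/2}Δ`.
[cite: Zhang2022LandauSiegel, §12 proof of Lemma 12.3, p. 70, tex L3564] -/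
theorem norm_circ_sub_residue_kernel1_le (hL : 1 ≤ ell D) {w : ℂ} (hw : ‖w‖ = alpha D) {X₂ : ℝ}
    (hX₂ : 1 ≤ X₂) (hX₂P : X₂ ≤ bigP D) (A βa βb : ℂ) {F : ℂ → ℂ} {Δ : ℝ}
    (hFi : CircleIntegrable (fun z : ℂ => F z * (((X₂ : ℝ) : ℂ) ^ z / z)) (beta6 D - w) (3 * alpha D))
    (hΔ : ∀ z ∈ sphere (beta6 D - w) (3 * alpha D),
      ‖F z - A * (z + w - beta6 D + βa) * (z + w - beta6 D + βb) / (z + w - beta6 D)‖ ≤ Δ) :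
    ‖(2 * π * I)⁻¹ * (∮ z in C(beta6 D - w, 3 * alpha D), F z * (((X₂ : ℝ) : ℂ) ^ z / z)) -
        A * ((βa * βb * ((X₂ : ℝ) : ℂ) ^ (beta6 D - w) - (βa - (beta6 D - w)) * (βb - (beta6 D - w))) /
          (beta6 D - w))‖ ≤ 6 * Real.exp (11 * π / 2) * Δ := by
  have hα : 0 < alpha D := alpha_pos' (by linarith)
  have hX₂0 : 0 < X₂ := by linarith
  have hMi := circleIntegrable_model_kernel1 hα hw A βa βb hX₂0
  have hMval : (2 * π * I)⁻¹ * (∮ z in C(beta6 D - w, 3 * alpha D),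
      A * (z + w - beta6 D + βa) * (z + w - beta6 D + βb) / (z + w - beta6 D) *
        (((X₂ : ℝ) : ℂ) ^ z / z)) =
      A * ((βa * βb * ((X₂ : ℝ) : ℂ) ^ (beta6 D - w) - (βa - (beta6 D - w)) * (βb - (beta6 D - w))) /
        (beta6 D - w)) := by
    have hcongr : (∮ z in C(beta6 D - w, 3 * alpha D),
        A * (z + w - beta6 D + βa) * (z + w - beta6 D + βb) / (z + w - beta6 D) *
          (((X₂ : ℝ) : ℂ) ^ z / z)) =
        ∮ z in C(beta6 D - w, 3 * alpha D), A • ((z + w - beta6 D + βa) * (z + w - beta6 D + βb) /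
          (z + w - beta6 D) * (((X₂ : ℝ) : ℂ) ^ z / z)) :=
      circleIntegral.integral_congr (by positivity) fun z _ => by simp only [smul_eq_mul]; ring
    rw [hcongr, circleIntegral.integral_smul, smul_eq_mul, ← mul_assoc, mul_comm ((2 * π * I)⁻¹) A,
      mul_assoc, circ_shift_kernel1_eq hα hw βa βb hX₂0]
  have hsub : (∮ z in C(beta6 D - w, 3 * alpha D), F z * (((X₂ : ℝ) : ℂ) ^ z / z)) -
      (∮ z in C(beta6 D - w, 3 * alpha D),
        A * (z + w - beta6 D + βa) * (z + w - beta6 D + βb) / (z + w - beta6 D) *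
          (((X₂ : ℝ) : ℂ) ^ z / z)) =
      ∮ z in C(beta6 D - w, 3 * alpha D),
        (F z - A * (z + w - beta6 D + βa) * (z + w - beta6 D + βb) / (z + w - beta6 D)) *
          (((X₂ : ℝ) : ℂ) ^ z / z) := by
    rw [← circleIntegral.integral_sub hFi hMi]
    exact circleIntegral.integral_congr (by positivity) fun z _ => by ring
  rw [← hMval, ← mul_sub, hsub]
  exact norm_circ_kernel1_le hL hw hX₂ hX₂P hΔ

/-! ## Bookkeeping: the size of `Δ`, and circle-integrability of the true integrand -/

/-- `Π̂ = ∏_{q∣dr}(1 − q⁻¹)⁻¹ ≥ 1` (a private copy of `GreenTao2008.GYCorr.one_le_prod_one_sub_inv_inv`,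
kept local to avoid the sieve import). [folklore] -/
private theorem one_le_hatPi (n : ℕ) : 1 ≤ ∏ q ∈ n.primeFactors, (1 - (q : ℝ)⁻¹)⁻¹ := by
  refine le_of_eq_of_le (Finset.prod_const_one (s := n.primeFactors)).symm
    (Finset.prod_le_prod (fun _ _ => zero_le_one) fun q hq => ?_)
  have hq2 : (2 : ℝ) ≤ q := by exact_mod_cast (Nat.prime_of_mem_primeFactors hq).two_le
  have h1 : 0 < 1 - (q : ℝ)⁻¹ := by
    have : (q : ℝ)⁻¹ ≤ 1 / 2 := by rw [inv_eq_one_div]; gcongr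
    linarith
  have h2 : 1 - (q : ℝ)⁻¹ ≤ 1 := by
    have : 0 ≤ (q : ℝ)⁻¹ := by positivity
    linarith
  exact (one_le_inv₀ h1).mpr h2

/-- **The size of `Δ`**: with `α = π𝓛⁻⁹`, `(1+𝓛)𝓛 ≤ 2𝓛²` and `Π̂ ≤ Π̂²` (`Π̂ ≥ 1`), the bound of
`norm_quot_sub_model_annulus` is at most `((1+16e^{9/2}π²K²)(24K²+2K) + 128e^{9/2}πK³C₈₃)·Π̂²·𝓛⁻¹⁵` — the
`O(𝓛⁻¹⁵)` of `Z22:§12.u025/u030`, RELATIVE by the factor `Π̂²` (as in `Skeleton.Lemma84Rel`, row G-d55-3).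
[cite: Zhang2022LandauSiegel, §12 proof of Lemma 12.2, p. 69; §8 Lemma 8.4] -/
theorem delta_le (h𝓛 : 1 ≤ Real.log D) {K C₈₃ : ℝ} (hK : 0 ≤ K) (hC₈₃ : 0 ≤ C₈₃) (n : ℕ) :
    (∏ q ∈ n.primeFactors, (1 - (q : ℝ)⁻¹)⁻¹) ^ 2 *
          ((1 + 16 * Real.exp (9 / 2) * π ^ 2 * K ^ 2) / Real.log D ^ 15) * (24 * K ^ 2 + 2 * K) +
        32 * K ^ 3 * (C₈₃ * (ell D ^ 8)⁻¹ * ∏ q ∈ n.primeFactors, (1 - (q : ℝ)⁻¹)⁻¹) *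
          (2 * Real.exp (9 / 2) * (1 + Real.log D) * Real.log D) * alpha D ≤
      ((1 + 16 * Real.exp (9 / 2) * π ^ 2 * K ^ 2) * (24 * K ^ 2 + 2 * K) +
          128 * Real.exp (9 / 2) * π * K ^ 3 * C₈₃) *
        (∏ q ∈ n.primeFactors, (1 - (q : ℝ)⁻¹)⁻¹) ^ 2 / Real.log D ^ 15 := by
  set P : ℝ := ∏ q ∈ n.primeFactors, (1 - (q : ℝ)⁻¹)⁻¹ with hP
  set L : ℝ := Real.log D with hLdef
  have hP1 : 1 ≤ P := one_le_hatPi n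
  have hL0 : 0 < L := by linarith
  have hell : ell D = L := by rw [ell]
  have hα : alpha D = π / L ^ 9 := by rw [alpha_eq]
  rw [hell, hα]
  have hE := Real.exp_pos (9 / 2)
  have hπ := Real.pi_pos
  -- the second term: `64e^{9/2}πK³C₈₃·P(1+L)/L¹⁶ ≤ 128e^{9/2}πK³C₈₃·P²/L¹⁵`
  have h2 : 32 * K ^ 3 * (C₈₃ * (L ^ 8)⁻¹ * P) * (2 * Real.exp (9 / 2) * (1 + L) * L) * (π / L ^ 9) ≤
      128 * Real.exp (9 / 2) * π * K ^ 3 * C₈₃ * P ^ 2 / L ^ 15 := by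
    have hPL : P * (1 + L) ≤ P ^ 2 * (2 * L) := by
      have a1 : P * (1 + L) ≤ P * (2 * L) := mul_le_mul_of_nonneg_left (by linarith) (by linarith)
      have hPP : P ≤ P ^ 2 := by nlinarith
      have a2 : P * (2 * L) ≤ P ^ 2 * (2 * L) := mul_le_mul_of_nonneg_right hPP (by linarith)
      exact a1.trans a2
    have e1 : 32 * K ^ 3 * (C₈₃ * (L ^ 8)⁻¹ * P) * (2 * Real.exp (9 / 2) * (1 + L) * L) * (π / L ^ 9) =
        (64 * Real.exp (9 / 2) * π * K ^ 3 * C₈₃ / L ^ 16) * (P * (1 + L)) := by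
      field_simp
      ring
    have e2 : 128 * Real.exp (9 / 2) * π * K ^ 3 * C₈₃ * P ^ 2 / L ^ 15 =
        (64 * Real.exp (9 / 2) * π * K ^ 3 * C₈₃ / L ^ 16) * (P ^ 2 * (2 * L)) := by
      field_simp
      ring
    rw [e1, e2]
    exact mul_le_mul_of_nonneg_left hPL (by positivity)
  have e3 : ((1 + 16 * Real.exp (9 / 2) * π ^ 2 * K ^ 2) * (24 * K ^ 2 + 2 * K) +
        128 * Real.exp (9 / 2) * π * K ^ 3 * C₈₃) * P ^ 2 / L ^ 15 =
      P ^ 2 * ((1 + 16 * Real.exp (9 / 2) * π ^ 2 * K ^ 2) / L ^ 15) * (24 * K ^ 2 + 2 * K) +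
        128 * Real.exp (9 / 2) * π * K ^ 3 * C₈₃ * P ^ 2 / L ^ 15 := by
    field_simp
  rw [e3]
  linarith

/-- **The TRUE integrand is circle-integrable** on `|z − (β₆ − w)| = 3α` (kernel `(X₂^z − X₁^z)/z`): with
`u = 1 − β₆ + w + z`, `Re u ≥ 1 − 3α > 9/10` (`α < 1/30`), so `𝔲` (holomorphic on `σ > 9/10`, Lemma 8.3 (i))
and the entire `L(·,χ)` (`χ ≠ χ₀`) are continuous there; the only further input is `L(u,χ) ≠ 0` ON the
circle (the exceptional zero lies inside; the owner's zero-free package supplies it).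
[cite: Zhang2022LandauSiegel, §12 proof of Lemma 12.2, p. 69; §8 Lemma 8.3 (i)] -/
theorem circleIntegrable_true_kernel2 [NeZero D] (χ : DirichletCharacter ℂ D) (hχ : χ ≠ 1) (c' : ℝ)
    (j : ℕ) (hα : 0 < alpha D) (hα30 : alpha D < 1 / 30) {w : ℂ} (hw : ‖w‖ = alpha D) (U : ℂ → ℂ)
    (hUd : DifferentiableOn ℂ U {s : ℂ | 9 / 10 < s.re})
    (hLnz : ∀ z ∈ sphere (beta6 D - w) (3 * alpha D), χ.LFunction (1 - beta6 D + w + z) ≠ 0)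
    {X₁ X₂ : ℝ} (hX₁ : 0 < X₁) (hX₂ : 0 < X₂) :
    CircleIntegrable (fun z : ℂ => U (1 - beta6 D + w + z) *
        χ.LFunction (1 - beta6 D + w + z + betaJ c' D (j + 1)) *
        χ.LFunction (1 - beta6 D + w + z + betaJ c' D (j + 2)) / χ.LFunction (1 - beta6 D + w + z) *
      ((((X₂ : ℝ) : ℂ) ^ z - ((X₁ : ℝ) : ℂ) ^ z) / z)) (beta6 D - w) (3 * alpha D) := by
  refine ContinuousOn.circleIntegrable (by positivity) ?_
  have h1 : ((X₁ : ℝ) : ℂ) ≠ 0 := by exact_mod_cast hX₁.ne'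
  have h2 : ((X₂ : ℝ) : ℂ) ≠ 0 := by exact_mod_cast hX₂.ne'
  have hLc : Continuous fun s : ℂ => χ.LFunction s :=
    (DirichletCharacter.differentiable_LFunction hχ).continuous
  have hO : IsOpen {s : ℂ | 9 / 10 < s.re} := isOpen_lt continuous_const Complex.continuous_re
  intro z hz
  obtain ⟨hn, hzlo, -, -⟩ := sphere_shift_bounds hα hw hz
  have hz0 : z ≠ 0 := by
    intro h; rw [h, norm_zero] at hzlo; linarith
  -- `Re u > 9/10`
  have hre : 9 / 10 < (1 - beta6 D + w + z).re := by
    have hr : |(z + w - beta6 D).re| ≤ 3 * alpha D := (Complex.abs_re_le_norm _).trans hn.le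
    have e : (1 - beta6 D + w + z).re = 1 + (z + w - beta6 D).re := by
      simp only [Complex.add_re, Complex.sub_re, Complex.one_re]; ring
    rw [e]
    have := (abs_le.mp hr).1
    linarith
  have hUc : ContinuousAt (fun z : ℂ => U (1 - beta6 D + w + z)) z := by
    have hUat : ContinuousAt U (1 - beta6 D + w + z) :=
      (hUd.differentiableAt (hO.mem_nhds hre)).continuousAt
    exact hUat.comp (by fun_prop)
  refine ContinuousAt.continuousWithinAt ?_
  refine ContinuousAt.mul ?_ ?_
  · refine ContinuousAt.div ?_ (hLc.continuousAt.comp (by fun_prop)) (hLnz z hz)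
    exact (hUc.mul (hLc.continuousAt.comp (by fun_prop))).mul (hLc.continuousAt.comp (by fun_prop))
  · refine ContinuousAt.div ?_ continuousAt_id hz0
    exact (continuousAt_id.const_cpow (Or.inl h2)).sub (continuousAt_id.const_cpow (Or.inl h1))

/-- **The TRUE integrand is circle-integrable** on `|z − (β₆ − w)| = 3α` (kernel `X₂^z/z`), same hypotheses.
[cite: Zhang2022LandauSiegel, §12 proof of Lemma 12.3, p. 70; §8 Lemma 8.3 (i)] -/
theorem circleIntegrable_true_kernel1 [NeZero D] (χ : DirichletCharacter ℂ D) (hχ : χ ≠ 1) (c' : ℝ)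
    (j : ℕ) (hα : 0 < alpha D) (hα30 : alpha D < 1 / 30) {w : ℂ} (hw : ‖w‖ = alpha D) (U : ℂ → ℂ)
    (hUd : DifferentiableOn ℂ U {s : ℂ | 9 / 10 < s.re})
    (hLnz : ∀ z ∈ sphere (beta6 D - w) (3 * alpha D), χ.LFunction (1 - beta6 D + w + z) ≠ 0)
    {X₂ : ℝ} (hX₂ : 0 < X₂) :
    CircleIntegrable (fun z : ℂ => U (1 - beta6 D + w + z) *
        χ.LFunction (1 - beta6 D + w + z + betaJ c' D (j + 1)) *
        χ.LFunction (1 - beta6 D + w + z + betaJ c' D (j + 2)) / χ.LFunction (1 - beta6 D + w + z) *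
      (((X₂ : ℝ) : ℂ) ^ z / z)) (beta6 D - w) (3 * alpha D) := by
  refine ContinuousOn.circleIntegrable (by positivity) ?_
  have h2 : ((X₂ : ℝ) : ℂ) ≠ 0 := by exact_mod_cast hX₂.ne'
  have hLc : Continuous fun s : ℂ => χ.LFunction s :=
    (DirichletCharacter.differentiable_LFunction hχ).continuous
  have hO : IsOpen {s : ℂ | 9 / 10 < s.re} := isOpen_lt continuous_const Complex.continuous_re
  intro z hz
  obtain ⟨hn, hzlo, -, -⟩ := sphere_shift_bounds hα hw hz
  have hz0 : z ≠ 0 := by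
    intro h; rw [h, norm_zero] at hzlo; linarith
  have hre : 9 / 10 < (1 - beta6 D + w + z).re := by
    have hr : |(z + w - beta6 D).re| ≤ 3 * alpha D := (Complex.abs_re_le_norm _).trans hn.le
    have e : (1 - beta6 D + w + z).re = 1 + (z + w - beta6 D).re := by
      simp only [Complex.add_re, Complex.sub_re, Complex.one_re]; ring
    rw [e]
    have := (abs_le.mp hr).1
    linarith
  have hUc : ContinuousAt (fun z : ℂ => U (1 - beta6 D + w + z)) z := by
    have hUat : ContinuousAt U (1 - beta6 D + w + z) :=
      (hUd.differentiableAt (hO.mem_nhds hre)).continuousAt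
    exact hUat.comp (by fun_prop)
  refine ContinuousAt.continuousWithinAt ?_
  refine ContinuousAt.mul ?_ ?_
  · refine ContinuousAt.div ?_ (hLc.continuousAt.comp (by fun_prop)) (hLnz z hz)
    exact (hUc.mul (hLc.continuousAt.comp (by fun_prop))).mul (hLc.continuousAt.comp (by fun_prop))
  · exact ContinuousAt.div (continuousAt_id.const_cpow (Or.inl h2)) continuousAt_id hz0

/-- **`L(1+s,χ) ≠ 0` on the annulus `α/2 ≤ |s| ≤ Kα`, from Lemma 5.8 alone**: with
`‖L(1+s,χ) − L′(1,χ)s‖ ≤ (1+16e^{9/2}π²K²)𝓛⁻¹⁵ ≤ ℓ₀α/4` and `‖L′(1,χ)s‖ ≥ ℓ₀α/2`, one gets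
`‖L(1+s,χ)‖ ≥ ℓ₀α/4 > 0` — so the exceptional zero `ρ̃` (inside `|s| < α/2`) is the only zero near `1` the
small contour has to avoid, and no zero-free input is needed ON the contour.
[cite: Zhang2022LandauSiegel, §5 Lemma 5.8; §12 proof of Lemma 12.2, p. 69] -/
theorem norm_LFunction_ge_annulus [NeZero D] (χ : DirichletCharacter ℂ D) (hprim : χ.IsPrimitive)
    (h𝓛 : 3 ≤ Real.log D) (hA : ‖χ.LFunction 1‖ ≤ 1 / Real.log D ^ 2022) {K ℓ₀ : ℝ}
    (hKL : K * π ≤ Real.log D ^ 8) (hℓ₀ : 0 < ℓ₀) (hℓ : ℓ₀ ≤ ‖deriv χ.LFunction 1‖)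
    (hE : (1 + 16 * Real.exp (9 / 2) * π ^ 2 * K ^ 2) / Real.log D ^ 15 ≤ ℓ₀ * alpha D / 4)
    {s : ℂ} (hs_lo : alpha D / 2 ≤ ‖s‖) (hs_hi : ‖s‖ ≤ K * alpha D) :
    ℓ₀ * alpha D / 4 ≤ ‖χ.LFunction (1 + s)‖ ∧ χ.LFunction (1 + s) ≠ 0 := by
  have hℓ1 : 1 ≤ ell D := by rw [ell]; linarith
  have hα : 0 < alpha D := alpha_pos' (by linarith)
  have hαeq : alpha D = π / Real.log D ^ 9 := alpha_eq D
  have hs' : ‖(1 + s) - 1‖ ≤ K * π / Real.log D ^ 9 := by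
    rw [add_sub_cancel_left]
    calc ‖s‖ ≤ K * alpha D := hs_hi
      _ = K * π / Real.log D ^ 9 := by rw [hαeq]; ring
  have h58 := Lemma58.lemma_5_8_of_le χ hprim h𝓛 hA hKL hs'
  rw [add_sub_cancel_left] at h58
  -- `‖ℓ s‖ ≥ ℓ₀ α/2`
  have hmain : ℓ₀ * alpha D / 2 ≤ ‖deriv χ.LFunction 1 * s‖ := by
    rw [norm_mul]
    calc ℓ₀ * alpha D / 2 = ℓ₀ * (alpha D / 2) := by ring
      _ ≤ ‖deriv χ.LFunction 1‖ * ‖s‖ := mul_le_mul hℓ hs_lo (by positivity) (norm_nonneg _)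
  have hlow : ℓ₀ * alpha D / 4 ≤ ‖χ.LFunction (1 + s)‖ := by
    have h := norm_sub_norm_le (deriv χ.LFunction 1 * s) (χ.LFunction (1 + s))
    rw [norm_sub_rev] at h
    linarith [h58.trans hE]
  refine ⟨hlow, fun h0 => ?_⟩
  rw [h0, norm_zero] at hlow
  have : 0 < ℓ₀ * alpha D / 4 := by positivity
  linarith

/-- **`L(u,χ) ≠ 0` on the circle `|z − (β₆ − w)| = 3α`**, `u = 1 − β₆ + w + z`, `|w| = α` (with
`‖L(u,χ)‖ ≥ ℓ₀α/4`): the annulus lemma at `s = z + w − β₆`, `|s| = 3α` (`K ≥ 3`). This discharges the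
hypothesis `hLnz` of `circleIntegrable_true_kernel2/1`. [cite: Zhang2022LandauSiegel, §5 Lemma 5.8; §12 proof of Lemma 12.2, p. 69] -/
theorem LFunction_ne_zero_on_shifted_sphere [NeZero D] (χ : DirichletCharacter ℂ D)
    (hprim : χ.IsPrimitive) (h𝓛 : 3 ≤ Real.log D) (hA : ‖χ.LFunction 1‖ ≤ 1 / Real.log D ^ 2022)
    {K ℓ₀ : ℝ} (hK3 : 3 ≤ K) (hKL : K * π ≤ Real.log D ^ 8) (hℓ₀ : 0 < ℓ₀)
    (hℓ : ℓ₀ ≤ ‖deriv χ.LFunction 1‖)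
    (hE : (1 + 16 * Real.exp (9 / 2) * π ^ 2 * K ^ 2) / Real.log D ^ 15 ≤ ℓ₀ * alpha D / 4)
    {w : ℂ} (hw : ‖w‖ = alpha D) {z : ℂ} (hz : z ∈ sphere (beta6 D - w) (3 * alpha D)) :
    ℓ₀ * alpha D / 4 ≤ ‖χ.LFunction (1 - beta6 D + w + z)‖ ∧
      χ.LFunction (1 - beta6 D + w + z) ≠ 0 := by
  have hℓ1 : 1 ≤ ell D := by rw [ell]; linarith
  have hα : 0 < alpha D := alpha_pos' (by linarith)
  obtain ⟨h1, -, -, -⟩ := sphere_shift_bounds hα hw hz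
  have hs_lo : alpha D / 2 ≤ ‖z + w - beta6 D‖ := by rw [h1]; linarith
  have hs_hi : ‖z + w - beta6 D‖ ≤ K * alpha D := by rw [h1]; nlinarith
  have h := norm_LFunction_ge_annulus χ hprim h𝓛 hA hKL hℓ₀ hℓ hE hs_lo hs_hi
  have e : 1 + (z + w - beta6 D) = 1 - beta6 D + w + z := by ring
  rw [e] at h
  exact h

/-! ## One-call form of the small-circle step (all side conditions discharged inside) -/

/-- **The small-circle step of `Z22:§12.u025` in one call.** For `χ` primitive, `χ ≠ χ₀`, `𝓛 = log D ≥ 3`,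
(A) `‖L(1,χ)‖ ≤ 𝓛⁻²⁰²²`, `α < 1/30`, `K ≥ 7 + 15|c′|` with `Kπ ≤ 𝓛⁸`, `0 < ℓ₀ ≤ |L′(1,χ)|` with
`(1+16e^{9/2}π²K²)𝓛⁻¹⁵ ≤ ℓ₀α/4`, `𝔲` holomorphic on `σ > 9/10` with `‖𝔲(u) − Π(d,r)‖ ≤ C₈₃𝓛⁻⁸Π̂` on
`|u−1| ≤ 5α` (Lemma 8.3 (i), (iii′)), `|w| = α` and `1 ≤ X₁, X₂ ≤ P`:
`‖(2πi)⁻¹∮_{C(β₆−w,3α)} 𝔲(u)L(u+β_{j+1})L(u+β_{j+2})/L(u)·(X₂^z − X₁^z)/z dz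
   − Π(d,r)L′(1,χ)·β_{j+1}β_{j+2}(X₂^{β₆−w} − X₁^{β₆−w})/(β₆−w)‖
 ≤ 12e^{11π/2}·((1+16e^{9/2}π²K²)(24K²+2K) + 128e^{9/2}πK³C₈₃)·Π̂²·𝓛⁻¹⁵` (`u = 1 − β₆ + w + z`) — the value
subtracted is `Π L′(1,χ)·circ025` (`Typed.Sec12B.circ025_eq`). Circle-integrability and `L(u) ≠ 0` on the
circle are discharged here (`LFunction_ne_zero_on_shifted_sphere`, `circleIntegrable_true_kernel2`).
[cite: Zhang2022LandauSiegel, §12 proof of Lemma 12.2, p. 69, tex L3534] -/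
theorem norm_circ_true_sub_main_kernel2 [NeZero D] (χ : DirichletCharacter ℂ D) (c' : ℝ)
    (hprim : χ.IsPrimitive) (hχ : χ ≠ 1) (h𝓛 : 3 ≤ Real.log D)
    (hA : ‖χ.LFunction 1‖ ≤ 1 / Real.log D ^ 2022) (hα30 : alpha D < 1 / 30)
    (j : ℕ) {d r : ℕ} (hd : d ≠ 0) (hr : r ≠ 0)
    (U : ℂ → ℂ) (hUd : DifferentiableOn ℂ U {s : ℂ | 9 / 10 < s.re})
    {C₈₃ K ℓ₀ : ℝ} (hC₈₃ : 0 ≤ C₈₃) (hK : 7 + 15 * |c'| ≤ K)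
    (hKL : K * π ≤ Real.log D ^ 8) (hℓ₀ : 0 < ℓ₀) (hℓ : ℓ₀ ≤ ‖deriv χ.LFunction 1‖)
    (hE : (1 + 16 * Real.exp (9 / 2) * π ^ 2 * K ^ 2) / Real.log D ^ 15 ≤ ℓ₀ * alpha D / 4)
    (hU3 : ∀ s : ℂ, ‖s - 1‖ ≤ 5 * alpha D → ‖U s - PiW χ d r‖ ≤
      C₈₃ * (ell D ^ 8)⁻¹ * ∏ q ∈ (d * r).primeFactors, (1 - (q : ℝ)⁻¹)⁻¹)
    {w : ℂ} (hw : ‖w‖ = alpha D) {X₁ X₂ : ℝ}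
    (hX₁ : 1 ≤ X₁) (hX₁P : X₁ ≤ bigP D) (hX₂ : 1 ≤ X₂) (hX₂P : X₂ ≤ bigP D) :
    ‖(2 * π * I)⁻¹ * (∮ z in C(beta6 D - w, 3 * alpha D),
          U (1 - beta6 D + w + z) * χ.LFunction (1 - beta6 D + w + z + betaJ c' D (j + 1)) *
              χ.LFunction (1 - beta6 D + w + z + betaJ c' D (j + 2)) /
              χ.LFunction (1 - beta6 D + w + z) *
            ((((X₂ : ℝ) : ℂ) ^ z - ((X₁ : ℝ) : ℂ) ^ z) / z)) -
        PiW χ d r * deriv χ.LFunction 1 *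
          (betaJ c' D (j + 1) * betaJ c' D (j + 2) *
            ((((X₂ : ℝ) : ℂ) ^ (beta6 D - w) - ((X₁ : ℝ) : ℂ) ^ (beta6 D - w)) / (beta6 D - w)))‖ ≤
      12 * Real.exp (11 * π / 2) *
        (((1 + 16 * Real.exp (9 / 2) * π ^ 2 * K ^ 2) * (24 * K ^ 2 + 2 * K) +
            128 * Real.exp (9 / 2) * π * K ^ 3 * C₈₃) *
          (∏ q ∈ (d * r).primeFactors, (1 - (q : ℝ)⁻¹)⁻¹) ^ 2 / Real.log D ^ 15) := by
  have hℓ1 : 1 ≤ ell D := by rw [ell]; linarith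
  have hlog1 : 1 ≤ Real.log D := by linarith
  have hα : 0 < alpha D := alpha_pos' (by linarith)
  have hK1 : 0 ≤ K := by linarith [abs_nonneg c']
  have hK3 : 3 ≤ K := by linarith [abs_nonneg c']
  have hX₁0 : 0 < X₁ := by linarith
  have hX₂0 : 0 < X₂ := by linarith
  -- `L(u) ≠ 0` on the circle, hence circle-integrability of the true integrand
  have hLnz : ∀ z ∈ sphere (beta6 D - w) (3 * alpha D), χ.LFunction (1 - beta6 D + w + z) ≠ 0 :=
    fun z hz => (LFunction_ne_zero_on_shifted_sphere χ hprim h𝓛 hA hK3 hKL hℓ₀ hℓ hE hw hz).2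
  have hFi := circleIntegrable_true_kernel2 χ hχ c' j hα hα30 hw U hUd hLnz hX₁0 hX₂0
  -- the pointwise comparison on the circle, with `Δ ≤ C·Π̂²·𝓛⁻¹⁵`
  have hΔ : ∀ z ∈ sphere (beta6 D - w) (3 * alpha D),
      ‖U (1 - beta6 D + w + z) * χ.LFunction (1 - beta6 D + w + z + betaJ c' D (j + 1)) *
            χ.LFunction (1 - beta6 D + w + z + betaJ c' D (j + 2)) /
            χ.LFunction (1 - beta6 D + w + z) -
          PiW χ d r * deriv χ.LFunction 1 * (z + w - beta6 D + betaJ c' D (j + 1)) *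
            (z + w - beta6 D + betaJ c' D (j + 2)) / (z + w - beta6 D)‖ ≤
        ((1 + 16 * Real.exp (9 / 2) * π ^ 2 * K ^ 2) * (24 * K ^ 2 + 2 * K) +
            128 * Real.exp (9 / 2) * π * K ^ 3 * C₈₃) *
          (∏ q ∈ (d * r).primeFactors, (1 - (q : ℝ)⁻¹)⁻¹) ^ 2 / Real.log D ^ 15 :=
    fun z hz => (norm_quot_sub_model_on_shifted_sphere χ c' hprim h𝓛 hA j hd hr U hC₈₃ hK hKL hℓ₀ hℓ
      hE hU3 hw hz).trans (delta_le hlog1 hK1 hC₈₃ (d * r))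
  have h := norm_circ_sub_residue_kernel2_le hℓ1 hw hX₁ hX₁P hX₂ hX₂P
    (PiW χ d r * deriv χ.LFunction 1) (betaJ c' D (j + 1)) (betaJ c' D (j + 2)) hFi hΔ
  refine h.trans (le_of_eq ?_)
  ring

/-- **The small-circle step of `Z22:§12.u030` in one call** (kernel `X₂^z/z`): under the same hypotheses
with `1 ≤ X₂ ≤ P`,
`‖(2πi)⁻¹∮_{C(β₆−w,3α)} 𝔲(u)L(u+β_{j+1})L(u+β_{j+2})/L(u)·X₂^z/z dz
   − Π(d,r)L′(1,χ)·(w − β₆ + β_{j+1} + β_{j+2} + β_{j+1}β_{j+2}(X₂^{β₆−w} − 1)/(β₆−w))‖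
 ≤ 6e^{11π/2}·((1+16e^{9/2}π²K²)(24K²+2K) + 128e^{9/2}πK³C₈₃)·Π̂²·𝓛⁻¹⁵` — the value subtracted is
`Π L′(1,χ)·circ030` (`Typed.Sec12B.U031_holds`, with `∫₁^{X₂}y^{β₆−w−1}dy = (X₂^{β₆−w} − 1)/(β₆−w)`).
[cite: Zhang2022LandauSiegel, §12 proof of Lemma 12.3, p. 70, tex L3564–L3577] -/
theorem norm_circ_true_sub_main_kernel1 [NeZero D] (χ : DirichletCharacter ℂ D) (c' : ℝ)
    (hprim : χ.IsPrimitive) (hχ : χ ≠ 1) (h𝓛 : 3 ≤ Real.log D)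
    (hA : ‖χ.LFunction 1‖ ≤ 1 / Real.log D ^ 2022) (hα30 : alpha D < 1 / 30)
    (j : ℕ) {d r : ℕ} (hd : d ≠ 0) (hr : r ≠ 0)
    (U : ℂ → ℂ) (hUd : DifferentiableOn ℂ U {s : ℂ | 9 / 10 < s.re})
    {C₈₃ K ℓ₀ : ℝ} (hC₈₃ : 0 ≤ C₈₃) (hK : 7 + 15 * |c'| ≤ K)
    (hKL : K * π ≤ Real.log D ^ 8) (hℓ₀ : 0 < ℓ₀) (hℓ : ℓ₀ ≤ ‖deriv χ.LFunction 1‖)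
    (hE : (1 + 16 * Real.exp (9 / 2) * π ^ 2 * K ^ 2) / Real.log D ^ 15 ≤ ℓ₀ * alpha D / 4)
    (hU3 : ∀ s : ℂ, ‖s - 1‖ ≤ 5 * alpha D → ‖U s - PiW χ d r‖ ≤
      C₈₃ * (ell D ^ 8)⁻¹ * ∏ q ∈ (d * r).primeFactors, (1 - (q : ℝ)⁻¹)⁻¹)
    {w : ℂ} (hw : ‖w‖ = alpha D) {X₂ : ℝ} (hX₂ : 1 ≤ X₂) (hX₂P : X₂ ≤ bigP D) :
    ‖(2 * π * I)⁻¹ * (∮ z in C(beta6 D - w, 3 * alpha D),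
          U (1 - beta6 D + w + z) * χ.LFunction (1 - beta6 D + w + z + betaJ c' D (j + 1)) *
              χ.LFunction (1 - beta6 D + w + z + betaJ c' D (j + 2)) /
              χ.LFunction (1 - beta6 D + w + z) *
            (((X₂ : ℝ) : ℂ) ^ z / z)) -
        PiW χ d r * deriv χ.LFunction 1 *
          (w - beta6 D + betaJ c' D (j + 1) + betaJ c' D (j + 2) +
            betaJ c' D (j + 1) * betaJ c' D (j + 2) *
              ((((X₂ : ℝ) : ℂ) ^ (beta6 D - w) - 1) / (beta6 D - w)))‖ ≤
      6 * Real.exp (11 * π / 2) *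
        (((1 + 16 * Real.exp (9 / 2) * π ^ 2 * K ^ 2) * (24 * K ^ 2 + 2 * K) +
            128 * Real.exp (9 / 2) * π * K ^ 3 * C₈₃) *
          (∏ q ∈ (d * r).primeFactors, (1 - (q : ℝ)⁻¹)⁻¹) ^ 2 / Real.log D ^ 15) := by
  have hℓ1 : 1 ≤ ell D := by rw [ell]; linarith
  have hlog1 : 1 ≤ Real.log D := by linarith
  have hα : 0 < alpha D := alpha_pos' (by linarith)
  have hK1 : 0 ≤ K := by linarith [abs_nonneg c']
  have hK3 : 3 ≤ K := by linarith [abs_nonneg c']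
  have hX₂0 : 0 < X₂ := by linarith
  obtain ⟨hc0, -, -⟩ := center_shift_bounds hα hw
  have hLnz : ∀ z ∈ sphere (beta6 D - w) (3 * alpha D), χ.LFunction (1 - beta6 D + w + z) ≠ 0 :=
    fun z hz => (LFunction_ne_zero_on_shifted_sphere χ hprim h𝓛 hA hK3 hKL hℓ₀ hℓ hE hw hz).2
  have hFi := circleIntegrable_true_kernel1 χ hχ c' j hα hα30 hw U hUd hLnz hX₂0
  have hΔ : ∀ z ∈ sphere (beta6 D - w) (3 * alpha D),
      ‖U (1 - beta6 D + w + z) * χ.LFunction (1 - beta6 D + w + z + betaJ c' D (j + 1)) *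
            χ.LFunction (1 - beta6 D + w + z + betaJ c' D (j + 2)) /
            χ.LFunction (1 - beta6 D + w + z) -
          PiW χ d r * deriv χ.LFunction 1 * (z + w - beta6 D + betaJ c' D (j + 1)) *
            (z + w - beta6 D + betaJ c' D (j + 2)) / (z + w - beta6 D)‖ ≤
        ((1 + 16 * Real.exp (9 / 2) * π ^ 2 * K ^ 2) * (24 * K ^ 2 + 2 * K) +
            128 * Real.exp (9 / 2) * π * K ^ 3 * C₈₃) *
          (∏ q ∈ (d * r).primeFactors, (1 - (q : ℝ)⁻¹)⁻¹) ^ 2 / Real.log D ^ 15 :=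
    fun z hz => (norm_quot_sub_model_on_shifted_sphere χ c' hprim h𝓛 hA j hd hr U hC₈₃ hK hKL hℓ₀ hℓ
      hE hU3 hw hz).trans (delta_le hlog1 hK1 hC₈₃ (d * r))
  have h := norm_circ_sub_residue_kernel1_le hℓ1 hw hX₂ hX₂P
    (PiW χ d r * deriv χ.LFunction 1) (betaJ c' D (j + 1)) (betaJ c' D (j + 2)) hFi hΔ
  -- the two closed forms of the model value agree (`β₆ − w ≠ 0`)
  have e : PiW χ d r * deriv χ.LFunction 1 *
        ((betaJ c' D (j + 1) * betaJ c' D (j + 2) * ((X₂ : ℝ) : ℂ) ^ (beta6 D - w) -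
            (betaJ c' D (j + 1) - (beta6 D - w)) * (betaJ c' D (j + 2) - (beta6 D - w))) /
          (beta6 D - w)) =
      PiW χ d r * deriv χ.LFunction 1 *
        (w - beta6 D + betaJ c' D (j + 1) + betaJ c' D (j + 2) +
          betaJ c' D (j + 1) * betaJ c' D (j + 2) *
            ((((X₂ : ℝ) : ℂ) ^ (beta6 D - w) - 1) / (beta6 D - w))) := by
    congr 1
    field_simp
    ring
  rw [e] at h
  exact h

end ShiftedCircle

end Literature.NumberTheory.LFunctions.Zhang2022.Lemma84
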